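import Mathlib.MeasureTheory.Integral.IntervalIntegral.IntegrationByParts
import Mathlib.MeasureTheory.Integral.IntervalIntegral.FundThmCalculus
import Mathlib.Analysis.SpecialFunctions.Integrals.Basic
import Mathlib.MeasureTheory.Integral.Prod
import Mathlib.Analysis.Complex.Basic
import HarnessLib

/-!
# The Sonin sign mechanism, I — ramps and tents (the autocorrelation identity)

Cell `rh-explicit`, seat cc-s2-1 (gen 6; lead rulings R8-22 (B) / R8-24), Lean lane item L1.  First of three
files (`SoninSignTent` → `SoninSignKernel` → `SoninSignMechanism`) proving, with NO spectral input, that a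
remainder density with a CUSP MINIMUM at the identity makes Connes–Consani's remainder functional
conditionally negative definite on small windows — the positive mechanism behind CC 2021 Theorem 1 near
`ρ = 1` and behind the positive side of the cell's Sonin threshold (`HOME/cc-s2-1/SONIN-TWO-SIDED.md`).

This file is elementary real analysis (all PROVED, no named facts):
* `integral_eq_mul_add_integral_min_mul_neg_deriv` — the **truncated-ramp representation**
  `∫₀ʳ ψ = ψ(R)·r + ∫₀ᴿ min(r,s)·(−ψ′(s)) ds` (`0 ≤ r ≤ R`, `ψ ∈ C¹`): a concave nondecreasing
  primitive is a nonnegative mixture of ramps `r ↦ min(r, s)`;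
* `integral_indicator_mul_indicator` — the tent `(s − |u−v|)₊` is the overlap length
  `|[u,u+s] ∩ [v,v+s]| = ∫ 1_{[u,u+s]} 1_{[v,v+s]}`;
* `integral_normSq_windowInt` — the **tent identity**
  `∫ ‖∫_{[w−s,w]} G‖² dw = ∫∫ (s − |u−v|)₊ G(u) conj G(v) du dv` for continuous compactly supported
  `G` (Fubini on `ℝ × ℝ²`; the tent is the autocorrelation of a window indicator, hence positive
  definite — the one identity the whole mechanism rests on).
References for the classical statements: Schoenberg 1938 (conditionally negative definite kernels),
Pólya 1949 (convexity criterion); the proofs here are the elementary ramp/autocorrelation route.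
-/

set_option linter.dupNamespace false  -- the mandated namespace repeats `RiemannHypothesis`

noncomputable section

open MeasureTheory Set intervalIntegral Complex
open scoped ComplexConjugate

namespace Summit.RiemannHypothesis.RiemannHypothesis.SoninSign

variable {G : ℝ → ℂ}

/-- **Truncated-ramp representation.** If `ψ ∈ C¹(ℝ)` then for `0 ≤ r ≤ R`:
`∫₀ʳ ψ = ψ(R)·r + ∫₀ᴿ min r s · (−ψ′(s)) ds`.  (For `ψ = φ′ ≥ 0` nonincreasing this writes the concave
nondecreasing `φ` as a nonnegative mixture of the ramps `r ↦ min r s`.) [folklore] -/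
theorem integral_eq_mul_add_integral_min_mul_neg_deriv {ψ : ℝ → ℝ} (hψ : ContDiff ℝ 1 ψ)
    {r R : ℝ} (hr : 0 ≤ r) (hrR : r ≤ R) :
    ∫ s in (0:ℝ)..r, ψ s = ψ R * r + ∫ s in (0:ℝ)..R, min r s * (-deriv ψ s) := by
  have hψc : Continuous ψ := hψ.continuous
  have hψd : ∀ x, HasDerivAt ψ (deriv ψ x) x := fun x =>
    (hψ.differentiable (by simp)).differentiableAt.hasDerivAt
  have hψ'c : Continuous (deriv ψ) := hψ.continuous_deriv le_rfl
  -- split the mixture integral at r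
  have hsplit : ∫ s in (0:ℝ)..R, min r s * (-deriv ψ s) =
      (∫ s in (0:ℝ)..r, min r s * (-deriv ψ s)) + ∫ s in r..R, min r s * (-deriv ψ s) := by
    rw [integral_add_adjacent_intervals]
    · exact ((continuous_const.min continuous_id).mul hψ'c.neg).intervalIntegrable _ _
    · exact ((continuous_const.min continuous_id).mul hψ'c.neg).intervalIntegrable _ _
  -- on [0, r]: min r s = s
  have h1 : ∫ s in (0:ℝ)..r, min r s * (-deriv ψ s) = ∫ s in (0:ℝ)..r, s * (-deriv ψ s) := by
    refine integral_congr fun s hs => ?_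
    rw [uIcc_of_le hr] at hs
    simp [min_eq_right hs.2]
  -- on [r, R]: min r s = r
  have h2 : ∫ s in r..R, min r s * (-deriv ψ s) = r * (ψ r - ψ R) := by
    have : ∫ s in r..R, min r s * (-deriv ψ s) = ∫ s in r..R, r * (-deriv ψ s) := by
      refine integral_congr fun s hs => ?_
      rw [uIcc_of_le hrR] at hs
      simp [min_eq_left hs.1]
    rw [this, intervalIntegral.integral_const_mul, intervalIntegral.integral_neg,
      integral_deriv_eq_sub (fun x _ => (hψ.differentiable (by simp)).differentiableAt)
        (hψ'c.intervalIntegrable _ _)]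
    ring
  -- on [0, r]: integration by parts ∫ s ψ'(s) = r ψ(r) − ∫ ψ
  have h3 : ∫ s in (0:ℝ)..r, s * (-deriv ψ s) = -(r * ψ r) + ∫ s in (0:ℝ)..r, ψ s := by
    have hparts := intervalIntegral.integral_mul_deriv_eq_deriv_mul (a := 0) (b := r)
      (u := fun s => s) (v := ψ) (u' := fun _ => 1) (v' := deriv ψ)
      (fun x _ => hasDerivAt_id x) (fun x _ => hψd x)
      (intervalIntegrable_const) (hψ'c.intervalIntegrable _ _)
    have : ∫ s in (0:ℝ)..r, s * (-deriv ψ s) = -∫ s in (0:ℝ)..r, s * deriv ψ s := by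
      rw [← intervalIntegral.integral_neg]; congr 1; ext s; ring
    rw [this, hparts]
    simp only [zero_mul, sub_zero, one_mul]
    ring
  rw [hsplit, h1, h2, h3]
  ring

/-- Length of the overlap of two windows of length `s`: `|[u,u+s] ∩ [v,v+s]| = (s − |u − v|)₊`. [folklore] -/
theorem volume_real_Icc_inter_Icc (u v s : ℝ) :
    (volume (Icc u (u + s) ∩ Icc v (v + s))).toReal = max (s - |u - v|) 0 := by
  rw [Icc_inter_Icc, Real.volume_Icc, ENNReal.toReal_ofReal']
  congr 1
  rcases le_total u v with h | h
  · rw [abs_of_nonpos (sub_nonpos.2 h), max_eq_right h, min_eq_left (by linarith)]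
    ring
  · rw [abs_of_nonneg (sub_nonneg.2 h), max_eq_left h, min_eq_right (by linarith)]
    ring

/-- The tent kernel `(s − |u−v|)₊` as the `w`-integral of the product of two window indicators. [folklore] -/
theorem integral_indicator_mul_indicator (u v s : ℝ) :
    ∫ w, (Icc u (u + s)).indicator (fun _ => (1:ℝ)) w * (Icc v (v + s)).indicator (fun _ => (1:ℝ)) w
      = max (s - |u - v|) 0 := by
  have h : ∀ w, (Icc u (u + s)).indicator (fun _ => (1:ℝ)) w * (Icc v (v + s)).indicator (fun _ => (1:ℝ)) w
      = (Icc u (u + s) ∩ Icc v (v + s)).indicator (fun _ => (1:ℝ)) w := by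
    intro w
    rw [← Set.indicator_indicator]
    by_cases hw : w ∈ Icc u (u + s)
    · simp [Set.indicator_of_mem hw]
    · simp [Set.indicator_of_notMem hw]
  simp_rw [h]
  rw [MeasureTheory.integral_indicator (measurableSet_Icc.inter measurableSet_Icc), setIntegral_const, smul_eq_mul,
    mul_one, Measure.real, volume_real_Icc_inter_Icc]

/-- `∫_w T((u,v),w) dw = (s − |u−v|)₊ · G(u) conj G(v)`. [folklore] -/
private theorem integral_tripleF (G : ℝ → ℂ) (s : ℝ) (p : ℝ × ℝ) :
    ∫ w, ((((Icc p.1 (p.1 + s)).indicator (fun _ => (1:ℝ)) w * (Icc p.2 (p.2 + s)).indicator (fun _ => (1:ℝ)) w : ℝ) : ℂ) * (G p.1 * conj (G p.2))) = ((max (s - |p.1 - p.2|) 0 : ℝ) : ℂ) * (G p.1 * conj (G p.2)) := by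
  rw [MeasureTheory.integral_mul_const, integral_complex_ofReal, integral_indicator_mul_indicator]

/-- The window integral as a whole-line integral against the indicator (`u ∈ [w−s, w] ↔ w ∈ [u, u+s]`). [folklore] -/
private theorem windowInt_eq_integral_indicator (G : ℝ → ℂ) (s w : ℝ) :
    (∫ u in Icc (w - s) w, G u) = ∫ u, (((Icc u (u + s)).indicator (fun _ => (1:ℝ)) w : ℝ) : ℂ) * G u := by
  rw [← MeasureTheory.integral_indicator measurableSet_Icc]
  refine integral_congr_ae (Filter.Eventually.of_forall fun u => ?_)
  by_cases hu : u ∈ Icc (w - s) w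
  · have hw : w ∈ Icc u (u + s) := ⟨hu.2, by linarith [hu.1]⟩
    simp [Set.indicator_of_mem hu, Set.indicator_of_mem hw]
  · have hw : w ∉ Icc u (u + s) := fun h => hu ⟨by linarith [h.2], h.1⟩
    simp [Set.indicator_of_notMem hu, Set.indicator_of_notMem hw]

/-- `‖H_s(w)‖² = ∫_{(u,v)} T((u,v),w)` (product of the window integral with its conjugate, as a
double integral). [folklore] -/
private theorem normSq_windowInt_eq_integral_prod (G : ℝ → ℂ) (s w : ℝ) :
    ((‖(∫ u in Icc (w - s) w, G u)‖ ^ 2 : ℝ) : ℂ) = ∫ p : ℝ × ℝ, ((((Icc p.1 (p.1 + s)).indicator (fun _ => (1:ℝ)) w * (Icc p.2 (p.2 + s)).indicator (fun _ => (1:ℝ)) w : ℝ) : ℂ) * (G p.1 * conj (G p.2))) := by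
  have hkey : ((‖(∫ u in Icc (w - s) w, G u)‖ ^ 2 : ℝ) : ℂ) = (∫ u in Icc (w - s) w, G u) * conj ((∫ u in Icc (w - s) w, G u)) := by
    rw [mul_conj, normSq_eq_norm_sq]
  rw [hkey, windowInt_eq_integral_indicator, ← integral_conj]
  -- product of integrals = integral over the product
  have h := MeasureTheory.integral_prod_mul (μ := (volume : Measure ℝ)) (ν := (volume : Measure ℝ))
    (f := fun u => (((Icc u (u + s)).indicator (fun _ => (1:ℝ)) w : ℝ) : ℂ) * G u)
    (g := fun v => conj ((((Icc v (v + s)).indicator (fun _ => (1:ℝ)) w : ℝ) : ℂ) * G v))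
  rw [← h]
  refine integral_congr_ae (Filter.Eventually.of_forall fun p => ?_)
  simp only [map_mul, Complex.conj_ofReal]
  push_cast
  ring

/-- `{q : ℝ × (ℝ × ℝ) | q.2.1 ≤ q.1 ∧ q.1 ≤ q.2.1 + s}` is measurable (closed). [folklore] -/
private theorem measurableSet_winFst (s : ℝ) : MeasurableSet {q : ℝ × (ℝ × ℝ) | q.2.1 ≤ q.1 ∧ q.1 ≤ q.2.1 + s} :=
  (isClosed_le (continuous_snd.fst) continuous_fst).measurableSet.inter
    ((isClosed_le continuous_fst (continuous_snd.fst.add continuous_const)).measurableSet)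

/-- `{q : ℝ × (ℝ × ℝ) | q.2.2 ≤ q.1 ∧ q.1 ≤ q.2.2 + s}` is measurable (closed). [folklore] -/
private theorem measurableSet_winSnd (s : ℝ) : MeasurableSet {q : ℝ × (ℝ × ℝ) | q.2.2 ≤ q.1 ∧ q.1 ≤ q.2.2 + s} :=
  (isClosed_le (continuous_snd.snd) continuous_fst).measurableSet.inter
    ((isClosed_le continuous_fst (continuous_snd.snd.add continuous_const)).measurableSet)

/-- The triple integrand as a function of `(w, (u, v))` is a product of two set indicators and a
continuous factor. [folklore] -/
private theorem tripleF_eq_indicator (G : ℝ → ℂ) (s : ℝ) (q : ℝ × (ℝ × ℝ)) :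
    ((((Icc q.2.1 (q.2.1 + s)).indicator (fun _ => (1:ℝ)) q.1 * (Icc q.2.2 (q.2.2 + s)).indicator (fun _ => (1:ℝ)) q.1 : ℝ) : ℂ) * (G q.2.1 * conj (G q.2.2))) =
      (({q : ℝ × (ℝ × ℝ) | q.2.1 ≤ q.1 ∧ q.1 ≤ q.2.1 + s}.indicator (fun _ => (1:ℝ)) q * {q : ℝ × (ℝ × ℝ) | q.2.2 ≤ q.1 ∧ q.1 ≤ q.2.2 + s}.indicator (fun _ => (1:ℝ)) q : ℝ) : ℂ) *
      (G q.2.1 * conj (G q.2.2)) := by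
  have h1 : (Icc q.2.1 (q.2.1 + s)).indicator (fun _ => (1:ℝ)) q.1 =
      {q : ℝ × (ℝ × ℝ) | q.2.1 ≤ q.1 ∧ q.1 ≤ q.2.1 + s}.indicator (fun _ => (1:ℝ)) q := by
    by_cases h : q.1 ∈ Icc q.2.1 (q.2.1 + s)
    · have h' : q ∈ {q : ℝ × (ℝ × ℝ) | q.2.1 ≤ q.1 ∧ q.1 ≤ q.2.1 + s} := h
      rw [Set.indicator_of_mem h, Set.indicator_of_mem h']
    · have h' : q ∉ {q : ℝ × (ℝ × ℝ) | q.2.1 ≤ q.1 ∧ q.1 ≤ q.2.1 + s} := h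
      rw [Set.indicator_of_notMem h, Set.indicator_of_notMem h']
  have h2 : (Icc q.2.2 (q.2.2 + s)).indicator (fun _ => (1:ℝ)) q.1 =
      {q : ℝ × (ℝ × ℝ) | q.2.2 ≤ q.1 ∧ q.1 ≤ q.2.2 + s}.indicator (fun _ => (1:ℝ)) q := by
    by_cases h : q.1 ∈ Icc q.2.2 (q.2.2 + s)
    · have h' : q ∈ {q : ℝ × (ℝ × ℝ) | q.2.2 ≤ q.1 ∧ q.1 ≤ q.2.2 + s} := h
      rw [Set.indicator_of_mem h, Set.indicator_of_mem h']
    · have h' : q ∉ {q : ℝ × (ℝ × ℝ) | q.2.2 ≤ q.1 ∧ q.1 ≤ q.2.2 + s} := h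
      rw [Set.indicator_of_notMem h, Set.indicator_of_notMem h']
  rw [h1, h2]

/-- Measurability of the triple integrand in `(w, (u, v))`. [folklore] -/
private theorem measurable_tripleF (hG : Continuous G) (s : ℝ) :
    Measurable (fun q : ℝ × (ℝ × ℝ) => ((((Icc q.2.1 (q.2.1 + s)).indicator (fun _ => (1:ℝ)) q.1 * (Icc q.2.2 (q.2.2 + s)).indicator (fun _ => (1:ℝ)) q.1 : ℝ) : ℂ) * (G q.2.1 * conj (G q.2.2)))) := by
  have h : (fun q : ℝ × (ℝ × ℝ) => ((((Icc q.2.1 (q.2.1 + s)).indicator (fun _ => (1:ℝ)) q.1 * (Icc q.2.2 (q.2.2 + s)).indicator (fun _ => (1:ℝ)) q.1 : ℝ) : ℂ) * (G q.2.1 * conj (G q.2.2)))) = fun q =>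
      (({q : ℝ × (ℝ × ℝ) | q.2.1 ≤ q.1 ∧ q.1 ≤ q.2.1 + s}.indicator (fun _ => (1:ℝ)) q * {q : ℝ × (ℝ × ℝ) | q.2.2 ≤ q.1 ∧ q.1 ≤ q.2.2 + s}.indicator (fun _ => (1:ℝ)) q : ℝ) : ℂ) *
      (G q.2.1 * conj (G q.2.2)) := funext (tripleF_eq_indicator G s)
  rw [h]
  refine (Complex.measurable_ofReal.comp ?_).mul ?_
  · exact ((measurable_const.indicator (measurableSet_winFst s)).mul
      (measurable_const.indicator (measurableSet_winSnd s)))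
  · exact (hG.measurable.comp measurable_snd.fst).mul
      (Complex.continuous_conj.measurable.comp (hG.measurable.comp measurable_snd.snd))

/-- Integrability of the triple integrand on `ℝ × (ℝ × ℝ)`: it is bounded and supported in a
compact box. [folklore] -/
private theorem integrable_tripleF (hG : Continuous G) (hGs : HasCompactSupport G) (s : ℝ) :
    Integrable (fun q : ℝ × (ℝ × ℝ) => ((((Icc q.2.1 (q.2.1 + s)).indicator (fun _ => (1:ℝ)) q.1 * (Icc q.2.2 (q.2.2 + s)).indicator (fun _ => (1:ℝ)) q.1 : ℝ) : ℂ) * (G q.2.1 * conj (G q.2.2))))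
      ((volume : Measure ℝ).prod ((volume : Measure ℝ).prod (volume : Measure ℝ))) := by
  obtain ⟨C, hC⟩ := hG.bounded_above_of_compact_support hGs
  obtain ⟨M, hM⟩ := (hGs.isCompact.isBounded).subset_closedBall 0
  have hsuppG : ∀ x, G x ≠ 0 → x ∈ Icc (-M) M := by
    intro x hx
    have := hM (subset_tsupport G hx)
    rwa [Real.closedBall_eq_Icc, zero_sub, zero_add] at this
  set box : Set (ℝ × (ℝ × ℝ)) := Icc (-M) (M + s) ×ˢ (Icc (-M) M ×ˢ Icc (-M) M) with hbox
  have hbox_meas : MeasurableSet box :=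
    measurableSet_Icc.prod (measurableSet_Icc.prod measurableSet_Icc)
  have hbox_fin : ((volume : Measure ℝ).prod ((volume : Measure ℝ).prod (volume : Measure ℝ))) box ≠ ⊤ := by
    rw [hbox, Measure.prod_prod, Measure.prod_prod]
    exact ENNReal.mul_ne_top measure_Icc_lt_top.ne
      (ENNReal.mul_ne_top measure_Icc_lt_top.ne measure_Icc_lt_top.ne)
  -- support inside the box
  have hzero : ∀ q : ℝ × (ℝ × ℝ), q ∉ box → ((((Icc q.2.1 (q.2.1 + s)).indicator (fun _ => (1:ℝ)) q.1 * (Icc q.2.2 (q.2.2 + s)).indicator (fun _ => (1:ℝ)) q.1 : ℝ) : ℂ) * (G q.2.1 * conj (G q.2.2))) = 0 := by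
    intro q hq
    by_contra hne
    have h1 : G q.2.1 ≠ 0 := by
      intro h0; apply hne; simp [h0]
    have h2 : G q.2.2 ≠ 0 := by
      intro h0; apply hne; simp [h0]
    have hw : q.1 ∈ Icc q.2.1 (q.2.1 + s) := by
      by_contra hw; apply hne; simp [Set.indicator_of_notMem hw]
    have hu := hsuppG _ h1
    have hv := hsuppG _ h2
    apply hq
    rw [hbox, Set.mem_prod, Set.mem_prod]
    refine ⟨⟨by linarith [hw.1, hu.1], by linarith [hw.2, hu.2]⟩, hu, hv⟩
  -- bound
  have hbound : ∀ q : ℝ × (ℝ × ℝ), ‖((((Icc q.2.1 (q.2.1 + s)).indicator (fun _ => (1:ℝ)) q.1 * (Icc q.2.2 (q.2.2 + s)).indicator (fun _ => (1:ℝ)) q.1 : ℝ) : ℂ) * (G q.2.1 * conj (G q.2.2)))‖ ≤ C * C := by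
    intro q
    have hind : ∀ (A : Set ℝ) (x : ℝ), |A.indicator (fun _ => (1:ℝ)) x| ≤ 1 := by
      intro A x
      by_cases hx : x ∈ A
      · simp [Set.indicator_of_mem hx]
      · simp [Set.indicator_of_notMem hx]
    rw [norm_mul, norm_mul, Complex.norm_real, Real.norm_eq_abs, abs_mul, Complex.norm_conj]
    have hC0 : 0 ≤ C := (norm_nonneg _).trans (hC 0)
    have hI : |(Icc q.2.1 (q.2.1 + s)).indicator (fun _ => (1:ℝ)) q.1| *
        |(Icc q.2.2 (q.2.2 + s)).indicator (fun _ => (1:ℝ)) q.1| ≤ 1 := by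
      calc _ ≤ (1:ℝ) * 1 := mul_le_mul (hind _ _) (hind _ _) (abs_nonneg _) zero_le_one
        _ = 1 := one_mul 1
    have hGG : ‖G q.2.1‖ * ‖G q.2.2‖ ≤ C * C :=
      mul_le_mul (hC _) (hC _) (norm_nonneg _) hC0
    calc _ ≤ (1:ℝ) * (C * C) :=
          mul_le_mul hI hGG (mul_nonneg (norm_nonneg _) (norm_nonneg _)) zero_le_one
      _ = C * C := one_mul _
  have hIntOn : IntegrableOn (fun q : ℝ × (ℝ × ℝ) => ((((Icc q.2.1 (q.2.1 + s)).indicator (fun _ => (1:ℝ)) q.1 * (Icc q.2.2 (q.2.2 + s)).indicator (fun _ => (1:ℝ)) q.1 : ℝ) : ℂ) * (G q.2.1 * conj (G q.2.2)))) box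
      ((volume : Measure ℝ).prod ((volume : Measure ℝ).prod (volume : Measure ℝ))) :=
    Measure.integrableOn_of_bounded hbox_fin (measurable_tripleF hG s).aestronglyMeasurable
      (Filter.Eventually.of_forall hbound)
  exact hIntOn.integrable_of_ae_notMem_eq_zero (Filter.Eventually.of_forall hzero)

/-- The pair kernel `(u,v) ↦ k(u−v)·G(u)·conj G(v)` has compact support when `G` has. [folklore] -/
theorem hasCompactSupport_pair (hGs : HasCompactSupport G) (k : ℝ → ℂ) :
    HasCompactSupport (fun p : ℝ × ℝ => k (p.1 - p.2) * (G p.1 * conj (G p.2))) := by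
  refine HasCompactSupport.intro (hGs.isCompact.prod hGs.isCompact) ?_
  intro p hp
  rw [Set.mem_prod, not_and_or] at hp
  rcases hp with h | h
  · simp [image_eq_zero_of_notMem_tsupport h]
  · simp [image_eq_zero_of_notMem_tsupport h]

/-- **The tent identity**: `∫ ‖H_s(w)‖² dw = ∫∫ (s − |u−v|)₊ G(u) conj G(v) du dv` — the tent kernel
is the autocorrelation of a window indicator, hence positive definite. [folklore] -/
theorem integral_normSq_windowInt (hG : Continuous G) (hGs : HasCompactSupport G) (s : ℝ) :
    ∫ w, ((‖∫ u in Icc (w - s) w, G u‖ ^ 2 : ℝ) : ℂ) =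
      ∫ u, ∫ v, ((max (s - |u - v|) 0 : ℝ) : ℂ) * (G u * conj (G v)) := by
  simp_rw [normSq_windowInt_eq_integral_prod G s]
  -- swap w and p = (u, v)
  have hswap := MeasureTheory.integral_integral_swap
    (μ := (volume : Measure ℝ)) (ν := ((volume : Measure ℝ).prod (volume : Measure ℝ)))
    (f := fun w p => ((((Icc p.1 (p.1 + s)).indicator (fun _ => (1:ℝ)) w * (Icc p.2 (p.2 + s)).indicator (fun _ => (1:ℝ)) w : ℝ) : ℂ) * (G p.1 * conj (G p.2)))) (integrable_tripleF hG hGs s)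
  rw [show (volume : Measure (ℝ × ℝ)) = (volume : Measure ℝ).prod (volume : Measure ℝ) from rfl]
  rw [hswap]
  simp_rw [integral_tripleF]
  -- split the pair integral
  have hcont : Continuous (fun p : ℝ × ℝ => ((max (s - |p.1 - p.2|) 0 : ℝ) : ℂ) * (G p.1 * conj (G p.2))) := by
    refine (Complex.continuous_ofReal.comp ?_).mul ?_
    · exact (continuous_const.sub (continuous_fst.sub continuous_snd).abs).max continuous_const
    · exact (hG.comp continuous_fst).mul (Complex.continuous_conj.comp (hG.comp continuous_snd))
  have hint : Integrable (fun p : ℝ × ℝ => ((max (s - |p.1 - p.2|) 0 : ℝ) : ℂ) * (G p.1 * conj (G p.2)))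
      ((volume : Measure ℝ).prod (volume : Measure ℝ)) :=
    hcont.integrable_of_hasCompactSupport
      (hasCompactSupport_pair hGs (fun x => ((max (s - |x|) 0 : ℝ) : ℂ)))
  rw [integral_prod _ hint]

/-- **The tent identity, product form**: `∫_{ℝ²} (s − |u−v|)₊ G(u) conj G(v) = ∫ ‖∫_{[w−s,w]} G‖² dw`
(a nonnegative real): the tent kernel is the autocorrelation of a window indicator, hence positive
definite. [folklore] -/
theorem integral_prod_tent_eq (hG : Continuous G) (hGs : HasCompactSupport G) (s : ℝ) :
    ∫ p : ℝ × ℝ, ((max (s - |p.1 - p.2|) 0 : ℝ) : ℂ) * (G p.1 * conj (G p.2)) =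
      ((∫ w, ‖∫ u in Icc (w - s) w, G u‖ ^ 2 : ℝ) : ℂ) := by
  rw [← integral_complex_ofReal]
  simp_rw [normSq_windowInt_eq_integral_prod G s]
  have hswap := MeasureTheory.integral_integral_swap
    (μ := (volume : Measure ℝ)) (ν := ((volume : Measure ℝ).prod (volume : Measure ℝ)))
    (f := fun w p => ((((Icc p.1 (p.1 + s)).indicator (fun _ => (1:ℝ)) w * (Icc p.2 (p.2 + s)).indicator (fun _ => (1:ℝ)) w : ℝ) : ℂ) * (G p.1 * conj (G p.2)))) (integrable_tripleF hG hGs s)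
  rw [show (volume : Measure (ℝ × ℝ)) = (volume : Measure ℝ).prod (volume : Measure ℝ) from rfl, hswap]
  simp_rw [integral_tripleF]

end Summit.RiemannHypothesis.RiemannHypothesis.SoninSign
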